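import Literature.Probability.LatticeModels.PolygonWordRowSteps
import Literature.Probability.LatticeModels.PercolationRowTransferProduct
import HarnessLib

/-!
# The word of a lattice polygon, III: the word distribution as a uniform average

Third of four files proving `Literature.Probability.LatticeModels.RowTransferExactness`.
The running distribution `latticeWordDist V W_A W_B b n` of the word (`PercolationPolygonWord`)
is the uniform average, over the subsets `A` of the bond labels `wordLabels V b n` drawn by the
first `n` letters, of the Dirac masses at the deterministic states `detState A V ![W_A, W_B] b n`
(`latticeWordDist_eq_average`); hence the word amplitude is `2^{-|labels|}` times the number of
label subsets whose deterministic state joins the two stars (`latticeWordAmplitude_eq_average`).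
Ingredients: the two-star transfer matrix is the average of the deterministic row steps
(`transferLin₂_eq_average`, as in `PercolationRowTransferProduct` for one star; Jacobsen–
Zinn-Justin, arXiv:cond-mat/0111374, §4), the row letter is the average of the deterministic
letters (`rowLetter_eq_average`), locality of `detState` (`detState_congr`), and the bijection
between subsets of the row labels and pairs (vertical bonds, horizontal bonds)
(`sum_powerset_rowLabels`). Folklore.
-/

noncomputable section

open Finset SimpleGraph
open scoped Classical

namespace Literature.Probability.LatticeModels

namespace PolygonWord

/-! ### Counting: the word distribution is the uniform average of deterministic states -/

section Count

/-- The Dirac vector at `s`. [folklore] -/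
def dvec {ι : Type*} (s : ι) : ι → ℝ := fun i => if i = s then 1 else 0

/-- Push-forward of a Dirac vector. [folklore] -/
theorem statePushforward_dvec {ι κ : Type*} [Fintype ι] [Fintype κ] (f : ι → κ) (s : ι) :
    statePushforward f (dvec s) = dvec (f s) := by
  funext k
  rw [statePushforward_apply]
  simp only [dvec]
  rw [Finset.sum_ite_eq' (univ.filter fun i => f i = k) s (fun _ => (1 : ℝ))]
  simp only [mem_filter, mem_univ, true_and]
  by_cases h : f s = k
  · rw [if_pos h, if_pos h.symm]
  · rw [if_neg h, if_neg (Ne.symm h)]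

/-- The initial vector is the Dirac vector at the free state. [folklore] -/
theorem rowInit₂_eq_dvec (S : Finset ℤ) : rowInit₂ S = dvec (RowState₂.free S) := rfl

/-- **`T_S` (two-star) is the uniform average of the push-forwards along the deterministic row
steps** `rowStep₂ O H`. [cite: JacobsenZinnjustin2001, §4] -/
theorem transferLin₂_eq_average (S : Finset ℤ) :
    transferLin₂ S = ((2 : ℝ) ^ S.card * 2 ^ (hEdges S).card)⁻¹ •
      ∑ OH ∈ (univ : Finset (Finset S)) ×ˢ (hEdges S).powerset,
        statePushforward (rowStep₂ OH.1 OH.2) := by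
  refine LinearMap.ext fun μ => funext fun π' => ?_
  simp only [transferLin₂, Matrix.vecMulLinear_apply, Matrix.vecMul, dotProduct,
    LinearMap.smul_apply, LinearMap.coe_sum, Finset.sum_apply, Pi.smul_apply, smul_eq_mul,
    statePushforward_apply, PercolationRowTransfer₂]
  simp_rw [Finset.sum_filter, div_eq_mul_inv]
  rw [Finset.sum_comm, Finset.mul_sum]
  refine Finset.sum_congr rfl fun π _ => ?_
  rw [← Finset.sum_filter, Finset.sum_const, nsmul_eq_mul]
  ring

variable {S₀ S : Finset ℤ}

/-- The deterministic letter with prescribed bond sets `O`, `H` and wire sets. [folklore] -/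
def detLetter (O H A B : Finset S) (π : RowState₂ S₀) : RowState₂ S :=
  wire B 1 (wire A 0 (rowStep₂ O H
    (insertState₂ (Finset.inter_subset_right : S₀ ∩ S ⊆ S)
      (restrictState₂ (Finset.inter_subset_left : S₀ ∩ S ⊆ S₀) π))))

/-- `detRow` is `detLetter` with the bonds read from `D` and the wires from `W`. [folklore] -/
theorem detRow_eq_detLetter (D : Set (Site 2 × Fin 2)) (W : Fin 2 → Set (Site 2)) (y : ℤ)
    (π : RowState₂ S₀) :
    detRow D W S₀ S y π =
      detLetter (vOpen D S y) (hOpen D S y) (rowWires (W 0) S y) (rowWires (W 1) S y) π :=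
  rfl

/-- **The row letter is the uniform average of the deterministic letters.** [folklore] -/
theorem rowLetter_eq_average (A B : Finset S) (μ : RowState₂ S₀ → ℝ) :
    rowLetter S₀ S A B μ = ((2 : ℝ) ^ S.card * 2 ^ (hEdges S).card)⁻¹ •
      ∑ OH ∈ (univ : Finset (Finset S)) ×ˢ (hEdges S).powerset,
        statePushforward (detLetter OH.1 OH.2 A B) μ := by
  simp only [rowLetter, LinearMap.comp_apply, transferLin₂_eq_average, LinearMap.smul_apply,
    LinearMap.coe_sum, Finset.sum_apply, map_smul, map_sum, wirePush, junctionInsert₂,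
    junctionRestrict₂]
  congr 1
  refine Finset.sum_congr rfl fun OH _ => ?_
  have : (detLetter OH.1 OH.2 A B : RowState₂ S₀ → RowState₂ S) =
      wire B 1 ∘ wire A 0 ∘ rowStep₂ OH.1 OH.2 ∘ insertState₂ Finset.inter_subset_right ∘
        restrictState₂ Finset.inter_subset_left := rfl
  rw [this, statePushforward_comp, statePushforward_comp, statePushforward_comp,
    statePushforward_comp]
  rfl

/-! #### Bond labels of a row and of a word -/

/-- The bond labels drawn by the letter of row `y` over the columns `S`: a vertical bond below
every column and a horizontal bond for every `hEdges S`. [folklore] -/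
def rowLabels (S : Finset ℤ) (y : ℤ) : Finset (Site 2 × Fin 2) :=
  (univ : Finset S).image (fun x : S => ((![(x : ℤ), y] : Site 2), (0 : Fin 2))) ∪
    (hEdges S).image (fun x : S => ((![(x : ℤ), y] : Site 2), (1 : Fin 2)))

/-- The bond labels of a pair (open vertical columns, open horizontal left columns). [folklore] -/
def labelsOf (S : Finset ℤ) (y : ℤ) (OH : Finset S × Finset S) : Finset (Site 2 × Fin 2) :=
  OH.1.image (fun x : S => ((![(x : ℤ), y] : Site 2), (0 : Fin 2))) ∪
    OH.2.image (fun x : S => ((![(x : ℤ), y] : Site 2), (1 : Fin 2)))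

/-- The bond labels drawn by the first `n` letters of the word of `V` based at row `b`.
[folklore] -/
def wordLabels (V : Finset (Site 2)) (b : ℤ) : ℕ → Finset (Site 2 × Fin 2)
  | 0 => ∅
  | n + 1 => wordLabels V b n ∪ rowLabels (rowCols V (b + ((n + 1 : ℕ) : ℤ))) (b + ((n + 1 : ℕ) : ℤ))

/-- Labels of row `y` sit in row `y`. [folklore] -/
theorem row_of_mem_rowLabels {S : Finset ℤ} {y : ℤ} {l : Site 2 × Fin 2} (h : l ∈ rowLabels S y) :
    l.1 1 = y := by
  simp only [rowLabels, mem_union, mem_image] at h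
  rcases h with ⟨x, -, rfl⟩ | ⟨x, -, rfl⟩ <;> simp

/-- Labels of a pair sit in the row. [folklore] -/
theorem row_of_mem_labelsOf {S : Finset ℤ} {y : ℤ} {OH : Finset S × Finset S} {l : Site 2 × Fin 2}
    (h : l ∈ labelsOf S y OH) : l.1 1 = y := by
  simp only [labelsOf, mem_union, mem_image] at h
  rcases h with ⟨x, -, rfl⟩ | ⟨x, -, rfl⟩ <;> simp

/-- Labels of the first `n` letters sit in rows `≤ b + n`. [folklore] -/
theorem row_le_of_mem_wordLabels (V : Finset (Site 2)) (b : ℤ) :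
    ∀ (n : ℕ) {l : Site 2 × Fin 2}, l ∈ wordLabels V b n → l.1 1 ≤ b + n
  | 0, l, h => by simp [wordLabels] at h
  | n + 1, l, h => by
    simp only [wordLabels, mem_union] at h
    rcases h with h | h
    · have := row_le_of_mem_wordLabels V b n h
      push_cast
      omega
    · exact (row_of_mem_rowLabels h).le

/-- The two label maps are injective and have disjoint images; cardinality of the row labels.
[folklore] -/
theorem card_rowLabels (S : Finset ℤ) (y : ℤ) : (rowLabels S y).card = S.card + (hEdges S).card := by
  unfold rowLabels
  rw [card_union_of_disjoint, card_image_of_injective, card_image_of_injective, card_univ,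
    Fintype.card_coe]
  · intro x x' h
    simp only [Prod.mk.injEq, vec_eq_vec_iff, and_true] at h
    exact Subtype.ext h
  · intro x x' h
    simp only [Prod.mk.injEq, vec_eq_vec_iff, and_true] at h
    exact Subtype.ext h
  · rw [Finset.disjoint_left]
    intro l h1 h2
    simp only [mem_image] at h1 h2
    obtain ⟨x, -, rfl⟩ := h1
    obtain ⟨x', -, h⟩ := h2
    simp at h

/-- The labels of earlier letters are disjoint from the labels of the next row. [folklore] -/
theorem disjoint_wordLabels_rowLabels (V : Finset (Site 2)) (b : ℤ) (n : ℕ) (S : Finset ℤ) :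
    Disjoint (wordLabels V b n) (rowLabels S (b + ((n + 1 : ℕ) : ℤ))) := by
  rw [Finset.disjoint_left]
  intro l h1 h2
  have e1 := row_le_of_mem_wordLabels V b n h1
  have e2 := row_of_mem_rowLabels h2
  push_cast at e1 e2
  omega

/-- Cardinality of the word labels. [folklore] -/
theorem card_wordLabels_succ (V : Finset (Site 2)) (b : ℤ) (n : ℕ) :
    (wordLabels V b (n + 1)).card = (wordLabels V b n).card +
      ((rowCols V (b + ((n + 1 : ℕ) : ℤ))).card + (hEdges (rowCols V (b + ((n + 1 : ℕ) : ℤ)))).card) := by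
  rw [wordLabels, card_union_of_disjoint (disjoint_wordLabels_rowLabels V b n _), card_rowLabels]

/-! #### Reading the bonds of a row back from the labels -/

/-- The vertical bonds read from `D₀ ∪ labelsOf (O, H)` are `O` when `D₀` avoids row `y`.
[folklore] -/
theorem vOpen_union_labelsOf {y : ℤ} {D₀ : Set (Site 2 × Fin 2)} (hD₀ : ∀ l ∈ D₀, l.1 1 ≠ y)
    (O H : Finset S) : vOpen (D₀ ∪ ↑(labelsOf S y (O, H))) S y = O := by
  ext x
  simp only [vOpen, mem_filter, mem_univ, true_and, Set.mem_union, Finset.mem_coe]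
  constructor
  · rintro (h | h)
    · exact absurd (by simp) (hD₀ _ h)
    · simp only [labelsOf, mem_union, mem_image] at h
      rcases h with ⟨x', hx', hxx'⟩ | ⟨x', -, h⟩
      · obtain ⟨h1, -⟩ := Prod.mk.inj hxx'
        rwa [← Subtype.ext ((vec_eq_vec_iff _ _ _ _).1 h1).1]
      · have := (Prod.mk.inj h).2
        simp at this
  · intro h
    refine Or.inr ?_
    simp only [labelsOf, mem_union, mem_image]
    exact Or.inl ⟨x, h, rfl⟩

/-- The horizontal bonds read from `D₀ ∪ labelsOf (O, H)` are `H` when `D₀` avoids row `y` and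
`H ⊆ hEdges S`. [folklore] -/
theorem hOpen_union_labelsOf {y : ℤ} {D₀ : Set (Site 2 × Fin 2)} (hD₀ : ∀ l ∈ D₀, l.1 1 ≠ y)
    (O H : Finset S) (hH : H ⊆ hEdges S) : hOpen (D₀ ∪ ↑(labelsOf S y (O, H))) S y = H := by
  ext x
  simp only [hOpen, mem_filter, mem_univ, true_and, Set.mem_union, Finset.mem_coe]
  constructor
  · rintro ⟨-, h | h⟩
    · exact absurd (by simp) (hD₀ _ h)
    · simp only [labelsOf, mem_union, mem_image] at h
      rcases h with ⟨x', -, h⟩ | ⟨x', hx', hxx'⟩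
      · have := (Prod.mk.inj h).2
        simp at this
      · obtain ⟨h1, -⟩ := Prod.mk.inj hxx'
        rwa [← Subtype.ext ((vec_eq_vec_iff _ _ _ _).1 h1).1]
  · intro h
    refine ⟨?_, Or.inr ?_⟩
    · simpa [hEdges] using hH h
    · simp only [labelsOf, mem_union, mem_image]
      exact Or.inr ⟨x, h, rfl⟩

/-- The labels read by the letter of row `y` are row labels. [folklore] -/
theorem vOpen_congr {D D' : Set (Site 2 × Fin 2)} {S : Finset ℤ} {y : ℤ}
    (h : ∀ l ∈ rowLabels S y, (l ∈ D ↔ l ∈ D')) : vOpen D S y = vOpen D' S y := by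
  ext x
  simp only [vOpen, mem_filter, mem_univ, true_and]
  refine h _ (Finset.mem_union_left _ (Finset.mem_image_of_mem _ (Finset.mem_univ x)))

/-- The labels read by the letter of row `y` are row labels. [folklore] -/
theorem hOpen_congr {D D' : Set (Site 2 × Fin 2)} {S : Finset ℤ} {y : ℤ}
    (h : ∀ l ∈ rowLabels S y, (l ∈ D ↔ l ∈ D')) : hOpen D S y = hOpen D' S y := by
  ext x
  simp only [hOpen, mem_filter, mem_univ, true_and]
  by_cases hx : (x : ℤ) + 1 ∈ S
  · have hxe : x ∈ hEdges S := by simpa [hEdges] using hx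
    rw [h _ (Finset.mem_union_right _ (Finset.mem_image_of_mem _ hxe))]
  · simp [hx]

/-- **Locality.** The deterministic word state after `n` rows only reads the labels
`wordLabels V b n`. [folklore] -/
theorem detState_congr {D D' : Set (Site 2 × Fin 2)} (V : Finset (Site 2)) (W : Fin 2 → Set (Site 2))
    (b : ℤ) : ∀ n : ℕ, (∀ l ∈ wordLabels V b n, (l ∈ D ↔ l ∈ D')) →
      detState D V W b n = detState D' V W b n
  | 0, _ => rfl
  | n + 1, h => by
    have ih := detState_congr V W b n fun l hl => h l (Finset.mem_union_left _ hl)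
    have h' : ∀ l ∈ rowLabels (rowCols V (b + ((n + 1 : ℕ) : ℤ))) (b + ((n + 1 : ℕ) : ℤ)),
        (l ∈ D ↔ l ∈ D') := fun l hl => h l (Finset.mem_union_right _ hl)
    simp only [detState]
    rw [ih, detRow_eq_detLetter, detRow_eq_detLetter, vOpen_congr h', hOpen_congr h']

/-- **Sums over the subsets of a disjoint union.** [folklore] -/
theorem sum_powerset_union {α M : Type*} [DecidableEq α] [AddCommMonoid M]
    {T T' : Finset α} (h : Disjoint T T') (f : Finset α → M) :
    ∑ A ∈ (T ∪ T').powerset, f A = ∑ A₀ ∈ T.powerset, ∑ A₁ ∈ T'.powerset, f (A₀ ∪ A₁) := by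
  rw [← Finset.sum_product' (f := fun A₀ A₁ => f (A₀ ∪ A₁))]
  refine (Finset.sum_nbij' (fun p => p.1 ∪ p.2) (fun A => (A ∩ T, A ∩ T')) ?_ ?_ ?_ ?_ ?_).symm
  · intro p hp
    rw [Finset.mem_product, Finset.mem_powerset, Finset.mem_powerset] at hp
    exact Finset.mem_powerset.2 (Finset.union_subset_union hp.1 hp.2)
  · intro A _
    rw [Finset.mem_product, Finset.mem_powerset, Finset.mem_powerset]
    exact ⟨Finset.inter_subset_right, Finset.inter_subset_right⟩
  · intro p hp
    rw [Finset.mem_product, Finset.mem_powerset, Finset.mem_powerset] at hp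
    have h1 : (p.1 ∪ p.2) ∩ T = p.1 := by
      rw [Finset.union_inter_distrib_right, Finset.inter_eq_left.2 hp.1,
        Finset.disjoint_iff_inter_eq_empty.1 (h.symm.mono_left hp.2), Finset.union_empty]
    have h2 : (p.1 ∪ p.2) ∩ T' = p.2 := by
      rw [Finset.union_inter_distrib_right, Finset.inter_eq_left.2 hp.2,
        Finset.disjoint_iff_inter_eq_empty.1 (h.mono_left hp.1), Finset.empty_union]
    rw [h1, h2]
  · intro A hA
    rw [Finset.mem_powerset] at hA
    change A ∩ T ∪ A ∩ T' = A
    rw [← Finset.inter_union_distrib_left, Finset.inter_eq_left.2 hA]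
  · intro p _; rfl

/-- **Subsets of the row labels are the pairs (vertical bonds, horizontal bonds).** [folklore] -/
theorem sum_powerset_rowLabels {M : Type*} [AddCommMonoid M] (S : Finset ℤ) (y : ℤ)
    (g : Finset (Site 2 × Fin 2) → M) :
    ∑ B ∈ (rowLabels S y).powerset, g B =
      ∑ OH ∈ (univ : Finset (Finset S)) ×ˢ (hEdges S).powerset, g (labelsOf S y OH) := by
  have hv : ∀ B : Finset (Site 2 × Fin 2), vOpen (↑B) S y = vOpen (∅ ∪ ↑B) S y := by simp
  have hh : ∀ B : Finset (Site 2 × Fin 2), hOpen (↑B) S y = hOpen (∅ ∪ ↑B) S y := by simp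
  refine (Finset.sum_nbij' (fun OH => labelsOf S y OH) (fun B => (vOpen (↑B) S y, hOpen (↑B) S y))
    ?_ ?_ ?_ ?_ ?_).symm
  · intro OH hOH
    rw [Finset.mem_product, Finset.mem_powerset] at hOH
    rw [Finset.mem_powerset]
    exact Finset.union_subset_union (Finset.image_subset_image (Finset.subset_univ _))
      (Finset.image_subset_image hOH.2)
  · intro B _
    rw [Finset.mem_product, Finset.mem_powerset]
    exact ⟨Finset.mem_univ _, hOpen_subset_hEdges _ _ _⟩
  · intro OH hOH
    rw [Finset.mem_product, Finset.mem_powerset] at hOH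
    obtain ⟨O, H⟩ := OH
    rw [hv, hh, vOpen_union_labelsOf (by simp), hOpen_union_labelsOf (by simp) _ _ hOH.2]
  · intro B hB
    rw [Finset.mem_powerset] at hB
    ext l
    simp only [labelsOf, mem_union, mem_image, vOpen, hOpen, mem_filter, mem_univ, true_and,
      Finset.mem_coe]
    constructor
    · rintro (⟨x, hx, rfl⟩ | ⟨x, hx, rfl⟩)
      · exact hx
      · exact hx.2
    · intro hl
      have hl' := hB hl
      simp only [rowLabels, mem_union, mem_image] at hl'
      rcases hl' with ⟨x, -, rfl⟩ | ⟨x, hx, rfl⟩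
      · exact Or.inl ⟨x, hl, rfl⟩
      · refine Or.inr ⟨x, ⟨?_, hl⟩, rfl⟩
        simpa [hEdges] using hx
  · intro OH _
    rfl

/-- One summand of the induction step: the deterministic state of `A ∪ labelsOf (O, H)` after
`n + 1` rows is the deterministic letter `(O, H)` applied to the state of `A` after `n` rows.
[folklore] -/
theorem detState_union_labelsOf (V : Finset (Site 2)) (W : Fin 2 → Set (Site 2)) (b : ℤ) (n : ℕ)
    {A : Finset (Site 2 × Fin 2)} (hA : A ⊆ wordLabels V b n)
    (OH : Finset (rowCols V (b + ((n + 1 : ℕ) : ℤ))) × Finset (rowCols V (b + ((n + 1 : ℕ) : ℤ))))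
    (hOH : OH.2 ⊆ hEdges (rowCols V (b + ((n + 1 : ℕ) : ℤ)))) :
    detState (↑(A ∪ labelsOf _ (b + ((n + 1 : ℕ) : ℤ)) OH)) V W b (n + 1) =
      detLetter OH.1 OH.2 (rowWires (W 0) _ (b + ((n + 1 : ℕ) : ℤ)))
        (rowWires (W 1) _ (b + ((n + 1 : ℕ) : ℤ))) (detState (↑A) V W b n) := by
  have hArow : ∀ l ∈ (↑A : Set (Site 2 × Fin 2)), l.1 1 ≠ b + ((n + 1 : ℕ) : ℤ) := by
    intro l hl
    have := row_le_of_mem_wordLabels V b n (hA hl)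
    push_cast at this ⊢
    omega
  simp only [detState]
  rw [detRow_eq_detLetter, Finset.coe_union]
  rw [detState_congr V W b n (D' := (↑A : Set (Site 2 × Fin 2)))]
  · obtain ⟨O, H⟩ := OH
    rw [vOpen_union_labelsOf hArow, hOpen_union_labelsOf hArow _ _ hOH]
  · intro l hl
    simp only [Set.mem_union, Finset.mem_coe, or_iff_left_iff_imp]
    intro hl'
    have h1 := row_of_mem_labelsOf hl'
    have h2 := row_le_of_mem_wordLabels V b n hl
    push_cast at h1 h2
    omega

/-- **The word distribution is the uniform average, over the bond labels drawn so far, of the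
Dirac masses at the deterministic word states.** [folklore] -/
theorem latticeWordDist_eq_average (V : Finset (Site 2)) (WA WB : Set (Site 2)) (b : ℤ) :
    ∀ n : ℕ, latticeWordDist V WA WB b n =
      ((2 : ℝ) ^ (wordLabels V b n).card)⁻¹ •
        ∑ A ∈ (wordLabels V b n).powerset, dvec (detState (↑A) V ![WA, WB] b n)
  | 0 => by
    simp only [latticeWordDist, wordLabels, Finset.powerset_empty, Finset.sum_singleton,
      Finset.card_empty, pow_zero, inv_one, one_smul, detState]
    rfl
  | n + 1 => by
    rw [latticeWordDist, latticeWordDist_eq_average V WA WB b n, rowLetter_eq_average]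
    simp only [map_smul, map_sum, statePushforward_dvec]
    rw [← Finset.smul_sum, smul_smul]
    -- the right-hand side
    rw [card_wordLabels_succ, wordLabels, sum_powerset_union (disjoint_wordLabels_rowLabels V b n _)]
    have hW0 : (![WA, WB] : Fin 2 → Set (Site 2)) 0 = WA := rfl
    have hW1 : (![WA, WB] : Fin 2 → Set (Site 2)) 1 = WB := rfl
    have inner : ∀ A ∈ (wordLabels V b n).powerset,
        ∑ B ∈ (rowLabels (rowCols V (b + ((n + 1 : ℕ) : ℤ))) (b + ((n + 1 : ℕ) : ℤ))).powerset,
          dvec (detState (↑(A ∪ B)) V ![WA, WB] b (n + 1)) =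
        ∑ OH ∈ (univ : Finset (Finset (rowCols V (b + ((n + 1 : ℕ) : ℤ))))) ×ˢ
            (hEdges (rowCols V (b + ((n + 1 : ℕ) : ℤ)))).powerset,
          dvec (detLetter OH.1 OH.2 (rowWires WA _ (b + ((n + 1 : ℕ) : ℤ)))
            (rowWires WB _ (b + ((n + 1 : ℕ) : ℤ))) (detState (↑A) V ![WA, WB] b n)) := by
      intro A hA
      rw [Finset.mem_powerset] at hA
      rw [sum_powerset_rowLabels]
      refine Finset.sum_congr rfl fun OH hOH => ?_
      rw [Finset.mem_product, Finset.mem_powerset] at hOH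
      rw [detState_union_labelsOf V _ b n hA OH hOH.2, hW0, hW1]
    rw [Finset.sum_congr rfl inner, Finset.sum_comm]
    congr 1
    rw [pow_add, pow_add]
    ring

/-- **The word amplitude counts the deterministic crossings.** [folklore] -/
theorem latticeWordAmplitude_eq_average (V : Finset (Site 2)) (WA WB : Set (Site 2)) (b : ℤ) (n : ℕ) :
    latticeWordAmplitude V WA WB b n =
      ((2 : ℝ) ^ (wordLabels V b n).card)⁻¹ *
        ((wordLabels V b n).powerset.filter fun A : Finset (Site 2 × Fin 2) =>
          (detState (↑A : Set (Site 2 × Fin 2)) V ![WA, WB] b n).StarsJoined).card := by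
  unfold latticeWordAmplitude
  rw [latticeWordDist_eq_average]
  simp only [Pi.smul_apply, Finset.sum_apply, smul_eq_mul]
  simp_rw [mul_assoc]
  rw [← Finset.mul_sum, Finset.card_filter, Nat.cast_sum]
  congr 1
  simp_rw [Finset.sum_mul]
  rw [Finset.sum_comm]
  refine Finset.sum_congr rfl fun A _ => ?_
  simp only [dvec, ite_mul, one_mul, zero_mul]
  rw [Finset.sum_ite_eq' univ]
  simp only [mem_univ, if_true, rowReadout₂]
  split_ifs <;> simp

end Count

end PolygonWord

end Literature.Probability.LatticeModels

end
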